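import Summits.Ventures.PercRepro.Night2ThreeTwoMissedKinds

/-!
# PercRepro — the cell `(3, 2)`: the column bound of the missed-point routing for `|V| ≥ 11`, at every target
(night-2, gen 25)

`Night2ThreeTwoMissedCol` bounds the distance-one load at the large targets (`|S ∖ K| ≥ 8`) through the sources of
ONE target.  Here the same common-line argument is run GLOBALLY on the hyperplanes of `G` that miss at most three
points: when `V = G ∖ K` has at least `11` points, any two of them meet (outside `K`) in a set of rank `≤ 2` with
`≥ 5` points, any two such sets share `≥ 2` points, so all these hyperplanes are nested (`H ∩ H' ⊆ H''`).  Their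
co-sets are then a nested family of `2`- and `3`-subsets of `V`: at most three pairs and at most four triples; with the
weighted load bound of `Night2ThreeTwoMissedKinds` every target receives at most `3/20 + 4/198 < 11/60 ≤ cap2`.

* `rkN_inter_clF_sdiff_coloops_le_two`, `inter_clF_subset_of_three` (three big hyperplanes whose missed sets are small
  against `V` are nested), `inter_clF_subset_of_three_eleven` (the case `|V| ≥ 11`, missed sets `≤ 3`);
* `card_le_four_of_inter_subset`: a nested family of co-triples has at most four members;
* `card_sources_le_card_image_clF`: the sources missing `m` points inject into the hyperplanes missing `m` points;
* **`dload_missed_le_cap2_of_eleven_le`**: the column bound at EVERY `S ⊆ G` when `|V| ≥ 11`.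
-/

namespace PercRepro.Shadow

open Finset PerFlat ThmH

variable {α : Type*} [DecidableEq α] {M : Matroid α} [M.Finite]

section GlobalLine

variable {G : Finset α}

open scoped Classical in
/-- **Two distinct hyperplanes of big thin members meet, outside the coloops, in a set of rank `≤ 2`** (cell `(3, 2)`). -/
theorem rkN_inter_clF_sdiff_coloops_le_two (hG : G ∈ flatsQ M (5 + 1)) (hd : (gr M \ G).card ≤ 5)
    (hk : kColoops M G = 2) {B B' : Finset α} (hthin : B ∈ thinMembers M 5 G) (hthin' : B' ∈ thinMembers M 5 G)
    (hne : clF M B ≠ clF M B') : rkN M ((clF M B ∩ clF M B') \ coloops M G) ≤ 2 := by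
  have hGg : G ⊆ gr M := (mem_flatsQ.1 hG).1
  have hBU : B ∈ Uq M (5 + 2) 5 := (mem_membersIn.1 (mem_thinMembers.1 hthin).1).1
  have hB'U : B' ∈ Uq M (5 + 2) 5 := (mem_membersIn.1 (mem_thinMembers.1 hthin').1).1
  have hHG : clF M B ⊆ G := (mem_membersIn.1 (mem_thinMembers.1 hthin).1).2
  have hH'G : clF M B' ⊆ G := (mem_membersIn.1 (mem_thinMembers.1 hthin').1).2
  have hK : coloops M G ⊆ B := coloops_subset_of_mem_thinMembers hG hd hthin
  have hK' : coloops M G ⊆ B' := coloops_subset_of_mem_thinMembers hG hd hthin'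
  set H := clF M B with hH
  set H' := clF M B' with hH'
  have hHr : rkN M H = 5 := rkN_clF_eq_five_of_mem_Uq hBU
  have hH'r : rkN M H' = 5 := rkN_clF_eq_five_of_mem_Uq hB'U
  have hnsub : ¬ H' ⊆ H := by
    intro hsub
    apply hne
    symm
    exact flat_eq_of_subset_of_eRk_eq (clF_mem_flatsQ_five_of_mem_Uq hBU)
      (by rw [hH', coe_clF]; exact M.isFlat_closure _) hsub
      (by rw [hH', coe_clF, M.eRk_closure_eq]; exact (mem_Uq.1 hB'U).2.1)
  obtain ⟨e, heH', heH⟩ := Finset.not_subset.1 hnsub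
  have hHclosed : clF M H = H := by
    rw [hH, ← Finset.coe_inj, coe_clF, coe_clF, M.closure_closure]
  have hU6 : 6 ≤ rkN M (H ∪ H') := by
    have h1 : rkN M (insert e H) = rkN M H + 1 :=
      rkN_insert_of_notMem_clF (hGg (hH'G heH')) (by rw [hHclosed]; exact heH)
    have h2 : insert e H ⊆ H ∪ H' := Finset.insert_subset (Finset.mem_union_right _ heH')
      Finset.subset_union_left
    have := rkN_mono (M := M) h2
    omega
  have hsub := rkN_submod (M := M) H H'
  have hKI : coloops M G ⊆ H ∩ H' := Finset.subset_inter (hK.trans (subset_clF hBU)) (hK'.trans (subset_clF hB'U))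
  have hcol : ∀ y ∈ coloops M G, y ∈ G ∧ y ∉ clF M (G.erase y) := fun y hy => mem_coloops.1 hy
  have hXG : (H ∩ H') \ coloops M G ⊆ G := fun a ha => hHG (Finset.mem_inter.1 (Finset.mem_sdiff.1 ha).1).1
  have hdisj : Disjoint (coloops M G) ((H ∩ H') \ coloops M G) := Finset.disjoint_sdiff
  have hunion : coloops M G ∪ ((H ∩ H') \ coloops M G) = H ∩ H' := Finset.union_sdiff_of_subset hKI
  have hI : rkN M (H ∩ H') = 2 + rkN M ((H ∩ H') \ coloops M G) := by
    have h := eRk_union_coloops hGg (coloops M G) hcol hXG hdisj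
    rw [hunion, eRk_eq_rkN, eRk_eq_rkN, ← kColoops_eq_card_coloops, hk] at h
    exact_mod_cast h
  omega

open scoped Classical in
/-- **The common line of three big hyperplanes** (cell `(3, 2)`): three thin members `B, B', B''` with
`cl B ≠ cl B'` whose missed sets are small against `V = G ∖ K` — `|π ∪ π'| + |π''| + 2 ≤ |V|` for the co-sets
`π = G ∖ cl B` — satisfy `cl B ∩ cl B' ⊆ cl B''`: the sets `(cl B ∩ cl B') ∖ K` and `(cl B ∩ cl B'') ∖ K` have rank
`≤ 2` and share `≥ 2` points, so the first lies in `cl B''`. -/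
theorem inter_clF_subset_of_three (hG : G ∈ flatsQ M (5 + 1)) (hd : (gr M \ G).card ≤ 5) (hk : kColoops M G = 2)
    (hs : ∀ e ∈ gr M, ∀ f ∈ gr M, e ≠ f → rkN M {e, f} = 2) {B B' B'' : Finset α}
    (hthin : B ∈ thinMembers M 5 G) (hthin' : B' ∈ thinMembers M 5 G) (hthin'' : B'' ∈ thinMembers M 5 G)
    (hsum : ((G \ clF M B) ∪ (G \ clF M B')).card + (G \ clF M B'').card + 2 ≤ (G \ coloops M G).card)
    (hne : clF M B ≠ clF M B') : clF M B ∩ clF M B' ⊆ clF M B'' := by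
  have hGg : G ⊆ gr M := (mem_flatsQ.1 hG).1
  have hHG : clF M B ⊆ G := (mem_membersIn.1 (mem_thinMembers.1 hthin).1).2
  have hK'' : coloops M G ⊆ B'' := coloops_subset_of_mem_thinMembers hG hd hthin''
  have hB''U : B'' ∈ Uq M (5 + 2) 5 := (mem_membersIn.1 (mem_thinMembers.1 hthin'').1).1
  by_cases hne' : clF M B = clF M B''
  · rw [hne']; exact Finset.inter_subset_left
  set R := (clF M B ∩ clF M B') \ coloops M G with hR
  set R' := (clF M B ∩ clF M B'') \ coloops M G with hR'
  have hRr : rkN M R ≤ 2 := rkN_inter_clF_sdiff_coloops_le_two hG hd hk hthin hthin' hne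
  have hRg : R ⊆ gr M := fun a ha => hGg (hHG (Finset.mem_inter.1 (Finset.mem_sdiff.1 ha).1).1)
  have hcard : 2 ≤ (R ∩ R').card := by
    have hsub : ((G \ coloops M G) \ ((G \ clF M B) ∪ (G \ clF M B'))) \ (G \ clF M B'') ⊆ R ∩ R' := by
      intro a ha
      simp only [Finset.mem_sdiff, Finset.mem_union, not_or, not_and, not_not] at ha
      obtain ⟨⟨⟨haG, haK⟩, haB, haB'⟩, haB''⟩ := ha
      simp only [hR, hR', Finset.mem_inter, Finset.mem_sdiff]
      exact ⟨⟨⟨haB haG, haB' haG⟩, haK⟩, ⟨haB haG, haB'' haG⟩, haK⟩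
    have h1c := Finset.card_le_card hsub
    have e1 := Finset.le_card_sdiff ((G \ clF M B) ∪ (G \ clF M B')) (G \ coloops M G)
    have e2 := Finset.le_card_sdiff (G \ clF M B'') ((G \ coloops M G) \ ((G \ clF M B) ∪ (G \ clF M B')))
    omega
  have hRcl : R ⊆ clF M (R ∩ R') := subset_clF_inter_of_rkN_le_two hs hRg hRr hcard
  have hmono : clF M (R ∩ R') ⊆ clF M B'' := by
    have h1 : R ∩ R' ⊆ clF M B'' := fun a ha =>
      (Finset.mem_inter.1 (Finset.mem_sdiff.1 (Finset.mem_inter.1 ha).2).1).2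
    rw [← Finset.coe_subset, coe_clF, coe_clF]
    have := M.closure_subset_closure (X := ((R ∩ R' : Finset α) : Set α)) (Y := ((clF M B'' : Finset α) : Set α))
      (by exact_mod_cast h1)
    rwa [coe_clF, M.closure_closure] at this
  intro a ha
  by_cases haK : a ∈ coloops M G
  · exact subset_clF hB''U (hK'' haK)
  · exact hmono (hRcl (Finset.mem_sdiff.2 ⟨ha, haK⟩))

open scoped Classical in
/-- The common line for `|V| ≥ 11`: three thin members missing at most three points each. -/
theorem inter_clF_subset_of_three_eleven (hG : G ∈ flatsQ M (5 + 1)) (hd : (gr M \ G).card ≤ 5)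
    (hk : kColoops M G = 2) (hs : ∀ e ∈ gr M, ∀ f ∈ gr M, e ≠ f → rkN M {e, f} = 2)
    (h11 : 11 ≤ (G \ coloops M G).card) {B B' B'' : Finset α} (hthin : B ∈ thinMembers M 5 G)
    (hthin' : B' ∈ thinMembers M 5 G) (hthin'' : B'' ∈ thinMembers M 5 G) (hm : (G \ clF M B).card ≤ 3)
    (hm' : (G \ clF M B').card ≤ 3) (hm'' : (G \ clF M B'').card ≤ 3) (hne : clF M B ≠ clF M B') :
    clF M B ∩ clF M B' ⊆ clF M B'' := by
  refine inter_clF_subset_of_three hG hd hk hs hthin hthin' hthin'' ?_ hne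
  have := Finset.card_union_le (G \ clF M B) (G \ clF M B')
  omega

/-- **A nested family of co-triples has at most four members**: subsets `H ⊆ S` with `|S ∖ H| = 3` such that any two
distinct members `H, H'` and any member `H''` satisfy `H ∩ H' ⊆ H''`. -/
theorem card_le_four_of_inter_subset {S : Finset α} {𝓑 : Finset (Finset α)} (hsub : ∀ B ∈ 𝓑, B ⊆ S)
    (hc : ∀ B ∈ 𝓑, (S \ B).card = 3)
    (hnest : ∀ B ∈ 𝓑, ∀ B' ∈ 𝓑, ∀ B'' ∈ 𝓑, B ≠ B' → B ∩ B' ⊆ B'') : 𝓑.card ≤ 4 := by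
  have hinj : ∀ B ∈ 𝓑, ∀ B' ∈ 𝓑, S \ B = S \ B' → B = B' := by
    intro B hB B' hB' h
    rw [← Finset.sdiff_sdiff_eq_self (hsub B hB), ← Finset.sdiff_sdiff_eq_self (hsub B' hB'), h]
  -- co-sets of any three members: `π'' ⊆ π ∪ π'`
  have hcov : ∀ B ∈ 𝓑, ∀ B' ∈ 𝓑, ∀ B'' ∈ 𝓑, B ≠ B' → S \ B'' ⊆ (S \ B) ∪ (S \ B') := by
    intro B hB B' hB' B'' hB'' hne a ha
    rw [Finset.mem_sdiff] at ha
    rw [Finset.mem_union, Finset.mem_sdiff, Finset.mem_sdiff]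
    by_contra hcon
    push Not at hcon
    exact ha.2 (hnest B hB B' hB' B'' hB'' hne (Finset.mem_inter.2 ⟨hcon.1 ha.1, hcon.2 ha.1⟩))
  by_contra hlt
  push Not at hlt
  obtain ⟨B₁, hB₁⟩ : 𝓑.Nonempty := Finset.card_pos.1 (by omega)
  obtain ⟨B₂, hB₂'⟩ : (𝓑.erase B₁).Nonempty := Finset.card_pos.1 (by rw [Finset.card_erase_of_mem hB₁]; omega)
  have hB₂ : B₂ ∈ 𝓑 := Finset.mem_of_mem_erase hB₂'
  have h21 : B₂ ≠ B₁ := Finset.ne_of_mem_erase hB₂'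
  obtain ⟨B₃, hB₃'⟩ : ((𝓑.erase B₁).erase B₂).Nonempty := Finset.card_pos.1
    (by rw [Finset.card_erase_of_mem hB₂', Finset.card_erase_of_mem hB₁]; omega)
  have hB₃ : B₃ ∈ 𝓑 := Finset.mem_of_mem_erase (Finset.mem_of_mem_erase hB₃')
  have h32 : B₃ ≠ B₂ := Finset.ne_of_mem_erase hB₃'
  have h31 : B₃ ≠ B₁ := Finset.ne_of_mem_erase (Finset.mem_of_mem_erase hB₃')
  set π₁ := S \ B₁ with hπ₁
  set π₂ := S \ B₂ with hπ₂
  set π₃ := S \ B₃ with hπ₃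
  have c1 : π₁.card = 3 := hc B₁ hB₁
  have c2 : π₂.card = 3 := hc B₂ hB₂
  have c3 : π₃.card = 3 := hc B₃ hB₃
  have h3in : π₃ ⊆ π₁ ∪ π₂ := hcov B₁ hB₁ B₂ hB₂ B₃ hB₃ (Ne.symm h21)
  have h1in : π₁ ⊆ π₂ ∪ π₃ := hcov B₂ hB₂ B₃ hB₃ B₁ hB₁ (Ne.symm h32)
  have h2in : π₂ ⊆ π₁ ∪ π₃ := hcov B₁ hB₁ B₃ hB₃ B₂ hB₂ (Ne.symm h31)
  -- `|π₁ ∩ π₂| = 2`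
  have hi12 : (π₁ ∩ π₂).card = 2 := by
    have hui := Finset.card_union_add_card_inter π₁ π₂
    have hle : (π₁ ∩ π₂).card ≤ 3 := (Finset.card_le_card Finset.inter_subset_left).trans c1.le
    rcases Nat.lt_or_ge (π₁ ∩ π₂).card 2 with hlt2 | hge2
    · exfalso
      rcases Nat.lt_or_ge (π₁ ∩ π₂).card 1 with h0 | h1
      · -- disjoint: `π₁ ⊆ π₃`, hence equal
        have hdisj : Disjoint π₁ π₂ := by
          rw [Finset.disjoint_iff_inter_eq_empty, ← Finset.card_eq_zero]; omega
        have hsub13 : π₁ ⊆ π₃ := by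
          intro a ha
          rcases Finset.mem_union.1 (h1in ha) with h | h
          · exact absurd (Finset.mem_inter.2 ⟨ha, h⟩) (Finset.disjoint_iff_inter_eq_empty.1 hdisj ▸
              Finset.notMem_empty a)
          · exact h
        exact h31 (hinj B₃ hB₃ B₁ hB₁ (Finset.eq_of_subset_of_card_le hsub13 (by omega)).symm)
      · -- one common point: `π₃` contains the two disjoint `2`-sets `π₁ ∖ π₂`, `π₂ ∖ π₁`
        have hsub3 : (π₁ \ π₂) ∪ (π₂ \ π₁) ⊆ π₃ := by
          intro a ha
          rcases Finset.mem_union.1 ha with h | h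
          · rw [Finset.mem_sdiff] at h
            rcases Finset.mem_union.1 (h1in h.1) with h' | h'
            · exact absurd h' h.2
            · exact h'
          · rw [Finset.mem_sdiff] at h
            rcases Finset.mem_union.1 (h2in h.1) with h' | h'
            · exact absurd h' h.2
            · exact h'
        have hdisj' : Disjoint (π₁ \ π₂) (π₂ \ π₁) := by
          rw [Finset.disjoint_left]
          intro a ha hb
          exact (Finset.mem_sdiff.1 hb).2 (Finset.mem_sdiff.1 ha).1
        have hc12 := Finset.card_sdiff_add_card_inter π₁ π₂
        have hc21 := Finset.card_sdiff_add_card_inter π₂ π₁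
        rw [Finset.inter_comm] at hc21
        have := Finset.card_le_card hsub3
        rw [Finset.card_union_of_disjoint hdisj'] at this
        omega
    · rcases Nat.lt_or_ge (π₁ ∩ π₂).card 3 with hlt3 | hge3
      · omega
      · exfalso
        have heq : π₁ ∩ π₂ = π₁ := Finset.eq_of_subset_of_card_le Finset.inter_subset_left (by omega)
        have heq' : π₁ ∩ π₂ = π₂ := Finset.eq_of_subset_of_card_le Finset.inter_subset_right (by omega)
        exact h21 (hinj B₂ hB₂ B₁ hB₁ (heq'.symm.trans heq))
  -- all co-sets lie in `U = π₁ ∪ π₂`, a `4`-set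
  set U := π₁ ∪ π₂ with hU
  have hU4 : U.card = 4 := by
    have hui := Finset.card_union_add_card_inter π₁ π₂
    rw [← hU] at hui; omega
  have hinU : ∀ B ∈ 𝓑, S \ B ⊆ U := by
    intro B hB
    by_cases hb1 : B = B₁
    · rw [hb1]; exact Finset.subset_union_left
    by_cases hb2 : B = B₂
    · rw [hb2]; exact Finset.subset_union_right
    exact hcov B₁ hB₁ B₂ hB₂ B hB (Ne.symm h21)
  have himg : 𝓑.image (fun B => S \ B) ⊆ U.powersetCard 3 := by
    intro π hπ
    rw [Finset.mem_image] at hπ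
    obtain ⟨B, hB, rfl⟩ := hπ
    rw [Finset.mem_powersetCard]
    exact ⟨hinU B hB, hc B hB⟩
  have hcardimg : (𝓑.image (fun B => S \ B)).card = 𝓑.card := by
    rw [Finset.card_image_of_injOn]
    intro B hB B' hB' h
    exact hinj B hB B' hB' h
  have := Finset.card_le_card himg
  rw [hcardimg, Finset.card_powersetCard, hU4] at this
  norm_num [Nat.choose] at this
  omega

end GlobalLine

section Column

variable {G : Finset α}

open scoped Classical in
/-- The sources of a target missing exactly `m` points inject into the hyperplanes missing `m` points. -/
theorem card_sources_le_card_image_clF {P : Finset α → Prop} [DecidablePred P] (S : Finset α) (m : ℕ) :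
    ((missedSources M 5 G P S).filter (fun B => (G \ clF M B).card = m)).card =
      (((missedSources M 5 G P S).filter (fun B => (G \ clF M B).card = m)).image (clF M)).card := by
  rw [Finset.card_image_of_injOn]
  intro B hB B' hB' h
  rw [Finset.mem_coe, Finset.mem_filter] at hB hB'
  rw [source_eq_inter_clF hB.1, source_eq_inter_clF hB'.1]
  rw [h]

open scoped Classical in
/-- **THE COLUMN BOUND OF THE MISSED-POINT ROUTING FOR `|V| ≥ 11`, AT EVERY TARGET** (cell `(3, 2)`): when
`G ∖ K` has at least `11` points, every `S ⊆ G` satisfies `dload S ≤ cap2 S` for the big members routed by `dshMissed`: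
at most three fat sources and four sources missing three points, `3/20 + 4/198 < 11/60`. -/
theorem dload_missed_le_cap2_of_eleven_le (hG : G ∈ flatsQ M (5 + 1)) (hd : (gr M \ G).card = 3)
    (hk : kColoops M G = 2) (hs : ∀ e ∈ gr M, ∀ f ∈ gr M, e ≠ f → rkN M {e, f} = 2)
    (hl : ∀ e ∈ gr M, M.Indep {e}) (h11 : 11 ≤ (G \ coloops M G).card) {P : Finset α → Prop} [DecidablePred P]
    (hP : ∀ B, P B → 4 ≤ (B \ coloops M G).card) (S : Finset α) :
    dload M 5 G P (dshMissed M 5 G) S ≤ cap2 M 5 G S := by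
  have hd' : (gr M \ G).card ≤ 5 := by omega
  have hw := dload_missed_le_weighted hG hd hk hs hl hP S
  by_cases hne : (missedSources M 5 G P S).Nonempty
  · obtain ⟨B, hB⟩ := hne
    obtain ⟨⟨hthin, hPB⟩, hBS, hc2, hsub⟩ := mem_missedSources.1 hB
    obtain ⟨z, x, hzx, hzx'⟩ := Finset.card_eq_two.1 hc2
    have hz : z ∈ G \ clF M B := hsub (by rw [hzx']; exact Finset.mem_insert_self _ _)
    have hx : x ∈ G \ clF M B := hsub (by rw [hzx']; exact Finset.mem_insert_of_mem (Finset.mem_singleton_self _))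
    have hSeq : S = insert x (insert z B) := by
      ext a
      constructor
      · intro ha
        by_cases haB : a ∈ B
        · exact Finset.mem_insert_of_mem (Finset.mem_insert_of_mem haB)
        · have : a ∈ S \ B := Finset.mem_sdiff.2 ⟨ha, haB⟩
          rw [hzx', Finset.mem_insert, Finset.mem_singleton] at this
          rcases this with rfl | rfl
          · exact Finset.mem_insert_of_mem (Finset.mem_insert_self _ _)
          · exact Finset.mem_insert_self _ _
      · intro ha
        rw [Finset.mem_insert, Finset.mem_insert] at ha
        rcases ha with rfl | rfl | haB
        · exact (Finset.mem_sdiff.1 (by rw [hzx']; exact Finset.mem_insert_of_mem (Finset.mem_singleton_self _) :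
            a ∈ S \ B)).1
        · exact (Finset.mem_sdiff.1 (by rw [hzx']; exact Finset.mem_insert_self _ _ : a ∈ S \ B)).1
        · exact hBS haB
    have hcap : (11 / 60 : ℚ) ≤ cap2 M 5 G S := by
      rw [hSeq]
      exact cap2_ge_of_missed_three_two hG hd hk hs hthin (hP B hPB) hz hx hzx
    -- the fat sources: at most three hyperplanes
    have hF : ((missedSources M 5 G P S).filter (fun B => (G \ clF M B).card = 2)).card ≤ 3 := by
      rw [card_sources_le_card_image_clF]
      apply card_le_three_of_inter_subset (S := G)
      · intro H hH
        obtain ⟨B', hB', rfl⟩ := Finset.mem_image.1 hH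
        exact (mem_membersIn.1 (mem_thinMembers.1 (mem_missedSources.1 (Finset.mem_filter.1 hB').1).1.1).1).2
      · intro H hH
        obtain ⟨B', hB', rfl⟩ := Finset.mem_image.1 hH
        exact (Finset.mem_filter.1 hB').2
      · intro H hH H' hH' H'' hH'' hne _
        obtain ⟨B₁, hB₁, rfl⟩ := Finset.mem_image.1 hH
        obtain ⟨B₂, hB₂, rfl⟩ := Finset.mem_image.1 hH'
        obtain ⟨B₃, hB₃, rfl⟩ := Finset.mem_image.1 hH''
        exact inter_clF_subset_of_three_eleven hG hd' hk hs h11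
          (mem_missedSources.1 (Finset.mem_filter.1 hB₁).1).1.1
          (mem_missedSources.1 (Finset.mem_filter.1 hB₂).1).1.1
          (mem_missedSources.1 (Finset.mem_filter.1 hB₃).1).1.1
          (by rw [(Finset.mem_filter.1 hB₁).2]; norm_num) (by rw [(Finset.mem_filter.1 hB₂).2]; norm_num)
          (by rw [(Finset.mem_filter.1 hB₃).2]; norm_num) hne
    -- the sources missing three points: at most four hyperplanes
    have hR : ((missedSources M 5 G P S).filter (fun B => (G \ clF M B).card = 3)).card ≤ 4 := by
      rw [card_sources_le_card_image_clF]
      apply card_le_four_of_inter_subset (S := G)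
      · intro H hH
        obtain ⟨B', hB', rfl⟩ := Finset.mem_image.1 hH
        exact (mem_membersIn.1 (mem_thinMembers.1 (mem_missedSources.1 (Finset.mem_filter.1 hB').1).1.1).1).2
      · intro H hH
        obtain ⟨B', hB', rfl⟩ := Finset.mem_image.1 hH
        exact (Finset.mem_filter.1 hB').2
      · intro H hH H' hH' H'' hH'' hne
        obtain ⟨B₁, hB₁, rfl⟩ := Finset.mem_image.1 hH
        obtain ⟨B₂, hB₂, rfl⟩ := Finset.mem_image.1 hH'
        obtain ⟨B₃, hB₃, rfl⟩ := Finset.mem_image.1 hH''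
        exact inter_clF_subset_of_three_eleven hG hd' hk hs h11
          (mem_missedSources.1 (Finset.mem_filter.1 hB₁).1).1.1
          (mem_missedSources.1 (Finset.mem_filter.1 hB₂).1).1.1
          (mem_missedSources.1 (Finset.mem_filter.1 hB₃).1).1.1
          (by rw [(Finset.mem_filter.1 hB₁).2]) (by rw [(Finset.mem_filter.1 hB₂).2])
          (by rw [(Finset.mem_filter.1 hB₃).2]) hne
    have hF' : (((missedSources M 5 G P S).filter (fun B => (G \ clF M B).card = 2)).card : ℚ) ≤ 3 := by
      exact_mod_cast hF
    have hR' : (((missedSources M 5 G P S).filter (fun B => (G \ clF M B).card = 3)).card : ℚ) ≤ 4 := by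
      exact_mod_cast hR
    linarith
  · rw [Finset.not_nonempty_iff_eq_empty] at hne
    rw [hne, Finset.filter_empty, Finset.filter_empty, Finset.card_empty] at hw
    have := cap2_nonneg (capS_nonneg' hG hd' S)
    push_cast at hw
    linarith

end Column

end PercRepro.Shadow
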